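import Literature.Barriers.SmoothPoincare4.WeaklyReducibleGenusThreeStandardOfSeparatingSplitting
import Literature.Topology.FourManifolds.LoopSurgeryHomotopySphereGKProofs
import Literature.Topology.FourManifolds.LargeKTrisectionClassificationUniv
import HarnessLib

/-!
# Aranda–Zupan's genus-three fact: the loop-surgery fact DISCHARGED through the classification

Barrier catalogue `Literature/Barriers/SmoothPoincare4/` (D-0021), companion of
`WeaklyReducibleGenusThreeStandard(Proofs|OfLoopSurgery|OfSeparatingSplitting).lean` and
`LowGenusTrisectionsStandardOfClassification.lean` (the named fact
`az2025_weaklyReducible_genusThree_homotopySphere_gk`: a smooth homotopy 4-sphere with a weakly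
reducible genus-three Gay–Kirby trisection is `S⁴`; Aranda–Zupan, arXiv:2503.04607, Thm. 1.3
restricted to homotopy spheres).  **Everything here is proved; no definition, no named fact.**

The printed-endgame assemblies of `WeaklyReducibleGenusThreeStandardOfSeparatingSplitting.lean`
take the loop-surgery fact `Literature.Topology.FourManifolds.msz_loopSurgery_homotopySphere_gk`
(*a homotopy 4-sphere which is a surgery on a loop of a GK-trisected `X′` in the
Meier–Schirmer–Zupan range is `S⁴`*; Aranda–Zupan §6 p. 24 with [MSZ16] and Pao) as the
hypothesis `hL`.  That fact is now REDUCED in the tree to the Meier–Schirmer–Zupan classification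
itself — `msz_loopSurgery_homotopySphere_gk_of_classification`
(`LoopSurgeryHomotopySphereGKProofs.lean`: `χ(X_ℓ) = χ(X′) + 2`, the classification,
`χ(#ᵏ(S¹ × S³) # εℂP²)`, winding number `±1` of the surgered loop by van Kampen, and both surgeries
on the fibre circle of `S¹ × S³` are `S⁴`) — and the classification is universe-free
(`msz_trisection_classification_gk_of_univ`, `LargeKTrisectionClassificationUniv.lean`).  This
file feeds the reduction in, removing `hL` from every assembly:

* `nonempty_diffeomorph_sphere_of_isCircleSurgery_of_mszRange_of_classification` — GIVEN the
  classification (any universe): a smooth homotopy 4-sphere `X : Type` which is a circle surgery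
  on a smoothly embedded loop of a smooth `X′ : Type` carrying a `(g; k)`-GK-trisection with some
  `g ≤ kᵢ + 1` is diffeomorphic to `S⁴`;
* `az2025_irreducibleCore_zero_of_classification_of_fiveChainSurgery` — Aranda–Zupan's
  IRREDUCIBLE CORE at universe `0` from the classification and the FIVE-CHAIN SURGERY STEP `h5`
  (Thm. 1.3 first part + Lemma 5.4 + Prop. 5.5, inline, NOT vendored — D-0026);
* `az2025_weaklyReducible_genusThree_homotopySphere_gk_of_classification_of_sep_of_fiveChainSurgery`
  — **where the fact stands**: at EVERY universe it follows from the classification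
  `msz_trisection_classification_gk` (any universe), the separating splitting fact
  `Trisection.isConnectedSum_of_reducing_separating` at universe `0`, and the five-chain surgery
  step for `X : Type`.

After this file the named inputs of the fact are exactly TWO existing named facts of the tree —
`msz_trisection_classification_gk` [MSZ16, Thm. 1.2] and
`Trisection.isConnectedSum_of_reducing_separating` [AZ25 §2 p. 6; GK16 §2] — and the five-chain
surgery step, the part of Aranda–Zupan's paper that is specific to it (Prop. 3.9, §4, §5 over
Waldhausen's theorem, Haken's lemma, Casson–Gordon/Scharlemann–Thompson thin position and the
wave property of genus-two Heegaard diagrams of `S³`, none of which the tree has).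

## References

* R. Aranda, A. Zupan, *Manifolds with weakly reducible genus-three trisections are standard*,
  arXiv:2503.04607 (2025), Thm. 1.3 (p. 2), §2 (pp. 6–7), Lemma 5.4, Prop. 5.5 (pp. 19–20),
  §6 (pp. 20–24). [ArandaZupan2025]
* J. Meier, T. Schirmer, A. Zupan, *Classification of trisections and the Generalized Property R
  Conjecture*, Proc. AMS 144 (2016) 4983–4997, Thm. 1.2. [MeierSchirmerZupan2016]
* J. Meier, A. Zupan, *Genus-two trisections are standard*, Geom. Topol. 21 (2017), Thm. 1.2.
  [MeierZupan2017]
* P. S. Pao, *The topological structure of 4-manifolds with effective torus actions. I*,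
  Trans. AMS 227 (1977). [Pao1977]
-/

noncomputable section

open scoped Manifold ContDiff Topology
open Set ContinuousMap

namespace Literature.Barriers.SmoothPoincare4

universe u v

open Literature.Topology.FourManifolds Literature.Topology.FourManifolds.Trisection

/-! ### The loop-surgery endgame from the classification -/

/-- **A homotopy 4-sphere which is a surgery on a loop of a GK-trisected manifold in the
Meier–Schirmer–Zupan range is `S⁴`, GIVEN the classification** (any universe).  Let `X′ : Type`
be a smooth 4-manifold with a `(g; k)`-GK-trisection, `g ≤ kᵢ + 1` for some `i`, `ℓ ⊂ X′` a
smoothly embedded loop and `X` a smooth homotopy 4-sphere with `IsCircleSurgery (𝓡 4) (𝓡 4) X′ X ℓ`;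
then `X ≅ S⁴`: the classification is universe-free (`msz_trisection_classification_gk_of_univ`),
gives the loop-surgery fact (`msz_loopSurgery_homotopySphere_gk_of_classification`: `χ(X′) = 0`
forces `X′ ≅ S¹ × S³`, the surgered loop is `±` the fibre by van Kampen, and `S_{±1} ≅ S′_{±1} ≅ S⁴`),
whose side conditions are discharged by
`nonempty_diffeomorph_sphere_of_isCircleSurgery_of_mszRange`.  Aranda–Zupan §6 p. 24 ("by
[MSZ16], `X′ ≅ S¹ × S³` … `X` is diffeomorphic to `S_p` or `S′_p`") with §2 p. 7
(`S_1 = S′_1 = S⁴`), for homotopy spheres.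
[cite: ArandaZupan2025, §6 p. 24 and §2 p. 7] [cite: MeierSchirmerZupan2016, Thm. 1.2] [cite: Pao1977, Thm. (S_1 ≅ S'_1 ≅ S⁴)] -/
theorem nonempty_diffeomorph_sphere_of_isCircleSurgery_of_mszRange_of_classification
    (hC : msz_trisection_classification_gk.{v})
    {X' : Type} [TopologicalSpace X'] [T2Space X'] [SecondCountableTopology X']
    [ChartedSpace (EuclideanSpace ℝ (Fin 4)) X'] [IsManifold (𝓡 4) ∞ X']
    {g : ℕ} {k : Fin 3 → ℕ} {S' : Fin 3 → Set X'} (hT' : IsGKTrisection X' g k S')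
    (hk : ∃ i, g ≤ k i + 1)
    {ℓ : Metric.sphere (0 : EuclideanSpace ℝ (Fin 2)) 1 → X'}
    (hℓ : Manifold.IsSmoothEmbedding (𝓡 1) (𝓡 4) ∞ ℓ)
    {X : Type} [TopologicalSpace X] [T2Space X] [SecondCountableTopology X]
    [ChartedSpace (EuclideanSpace ℝ (Fin 4)) X] [IsManifold (𝓡 4) ∞ X]
    (hs : IsCircleSurgery (𝓡 4) (𝓡 4) X' X ℓ)
    (e : X ≃ₕ (Metric.sphere (0 : EuclideanSpace ℝ (Fin 5)) 1)) :
    Nonempty (X ≃ₘ⟮𝓡 4, 𝓡 4⟯ (Metric.sphere (0 : EuclideanSpace ℝ (Fin 5)) 1)) :=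
  nonempty_diffeomorph_sphere_of_isCircleSurgery_of_mszRange
    (msz_loopSurgery_homotopySphere_gk_of_classification
      (msz_trisection_classification_gk_of_univ hC)) hT' hk hℓ hs e

/-! ### The irreducible core from the classification and the five-chain surgery step -/

/-- **Aranda–Zupan's irreducible core at universe `0` from the classification and the five-chain
surgery step** (PROVED glue).  GIVEN `msz_trisection_classification_gk` (any universe) and, as
the inline hypothesis `h5`, the FIVE-CHAIN SURGERY STEP of the printed proof in tree vocabulary —
a closed connected oriented `X : Type` with a balanced `(3; 1)`-trisection `S` carrying a weak
reduction (`c` bounding in `H_0`, `c′` in `H_1` and `H_2`, fixed labels) and no reducing curve is a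
circle surgery `IsCircleSurgery (𝓡 4) (𝓡 4) X′ X ℓ` on a smoothly embedded loop `ℓ` of some smooth
`X′ : Type` with a genus-`2` GK-trisection in the MSZ range (Aranda–Zupan: Thm. 1.3 first part
"either `T` is reducible or `T` contains a five-chain", Lemma 5.4 "`(Σ_{α₁}; α′, β′, γ′)` is a
`(g − 1; k₁, k₂, k₃ + 1)`-trisection diagram", Prop. 5.5 "`X` is obtained by surgery on a loop in
`X′`") — every such `X` homotopy equivalent to `S⁴` is diffeomorphic to `S⁴`.  This is
`az2025_irreducibleCore_zero_of_loopSurgery_of_fiveChainSurgery` with its loop-surgery hypothesis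
fed by `msz_loopSurgery_homotopySphere_gk_of_classification`.
[cite: ArandaZupan2025, Thm. 1.3, Lemma 5.4, Prop. 5.5, §6 p. 24] [cite: MeierSchirmerZupan2016, Thm. 1.2] -/
theorem az2025_irreducibleCore_zero_of_classification_of_fiveChainSurgery
    (hC : msz_trisection_classification_gk.{v})
    (h5 : ∀ (X : Type) [TopologicalSpace X] [T2Space X] [SecondCountableTopology X]
      [ChartedSpace (EuclideanSpace ℝ (Fin 4)) X] [IsManifold (𝓡 4) ∞ X] [CompactSpace X]
      [ConnectedSpace X] (_ : SmoothOrientation (𝓡 4) X) (S : Fin 3 → Set X),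
      IsBalancedGKTrisection X 3 1 S →
      (∃ c c' : Set X, IsCurve S c ∧ IsCurve S c' ∧ Disjoint c c' ∧
        IsNonSeparating S c ∧ IsNonSeparating S c' ∧
        BoundsDisc S (spineHandlebody S 0) c ∧ BoundsDisc S (spineHandlebody S 1) c' ∧
        BoundsDisc S (spineHandlebody S 2) c') →
      ¬ IsReducible S →
      ∃ (X' : Type) (_ : TopologicalSpace X') (_ : T2Space X') (_ : SecondCountableTopology X')
        (_ : ChartedSpace (EuclideanSpace ℝ (Fin 4)) X') (_ : IsManifold (𝓡 4) ∞ X')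
        (k' : Fin 3 → ℕ) (S' : Fin 3 → Set X')
        (ℓ : Metric.sphere (0 : EuclideanSpace ℝ (Fin 2)) 1 → X'),
        IsGKTrisection X' 2 k' S' ∧ (∃ i, 2 ≤ k' i + 1) ∧
          Manifold.IsSmoothEmbedding (𝓡 1) (𝓡 4) ∞ ℓ ∧ IsCircleSurgery (𝓡 4) (𝓡 4) X' X ℓ)
    (X : Type) [TopologicalSpace X] [T2Space X] [SecondCountableTopology X]
    [ChartedSpace (EuclideanSpace ℝ (Fin 4)) X] [IsManifold (𝓡 4) ∞ X] [CompactSpace X]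
    [ConnectedSpace X] (o : SmoothOrientation (𝓡 4) X) (S : Fin 3 → Set X)
    (hT : IsBalancedGKTrisection X 3 1 S)
    (hwr : ∃ c c' : Set X, IsCurve S c ∧ IsCurve S c' ∧ Disjoint c c' ∧
      IsNonSeparating S c ∧ IsNonSeparating S c' ∧
      BoundsDisc S (spineHandlebody S 0) c ∧ BoundsDisc S (spineHandlebody S 1) c' ∧
      BoundsDisc S (spineHandlebody S 2) c')
    (hirr : ¬ IsReducible S) (e : X ≃ₕ (Metric.sphere (0 : EuclideanSpace ℝ (Fin (4 + 1))) 1)) :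
    Nonempty (X ≃ₘ⟮𝓡 4, 𝓡 4⟯ (Metric.sphere (0 : EuclideanSpace ℝ (Fin (4 + 1))) 1)) :=
  az2025_irreducibleCore_zero_of_loopSurgery_of_fiveChainSurgery
    (msz_loopSurgery_homotopySphere_gk_of_classification
      (msz_trisection_classification_gk_of_univ hC)) h5 X o S hT hwr hirr e

/-! ### Where the fact stands -/

/-- **Aranda–Zupan's homotopy-sphere fact, at every universe, from the Meier–Schirmer–Zupan
classification (any universe), the separating splitting fact (universe `0`) and the five-chain
surgery step (for `X : Type`)** — PROVED glue:
`az2025_weaklyReducible_genusThree_homotopySphere_gk_of_classification_of_sep_of_loopSurgery_of_fiveChainSurgery'`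
with its loop-surgery hypothesis `hL` fed by `msz_loopSurgery_homotopySphere_gk_of_classification`
(and the classification moved to universe `0` by `msz_trisection_classification_gk_of_univ`).
Reducible branch: Aranda–Zupan §6 p. 20 first paragraph and §2 p. 6 (the reducing curve separates
on a simply connected `X` — `Trisection.not_simplyConnectedSpace_of_reducing_nonseparating` — and
the summands are homotopy spheres of trisection genus `≤ 2`, [MZ17b]); irreducible branch:
Prop. 3.9, §4, Thm. 1.3 first part, Lemma 5.4, Prop. 5.5 (the inline hypothesis `h5`) and the
[MSZ16]/Pao endgame, now a consequence of the classification.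
[cite: ArandaZupan2025, Thm. 1.3 (p. 2), §6 (pp. 20–24), Lemma 5.4, Prop. 5.5] [cite: MeierSchirmerZupan2016, Thm. 1.2] -/
theorem az2025_weaklyReducible_genusThree_homotopySphere_gk_of_classification_of_sep_of_fiveChainSurgery
    (hC : msz_trisection_classification_gk.{v})
    (hsep₀ : isConnectedSum_of_reducing_separating.{0})
    (h5 : ∀ (X : Type) [TopologicalSpace X] [T2Space X] [SecondCountableTopology X]
      [ChartedSpace (EuclideanSpace ℝ (Fin 4)) X] [IsManifold (𝓡 4) ∞ X] [CompactSpace X]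
      [ConnectedSpace X] (_ : SmoothOrientation (𝓡 4) X) (S : Fin 3 → Set X),
      IsBalancedGKTrisection X 3 1 S →
      (∃ c c' : Set X, IsCurve S c ∧ IsCurve S c' ∧ Disjoint c c' ∧
        IsNonSeparating S c ∧ IsNonSeparating S c' ∧
        BoundsDisc S (spineHandlebody S 0) c ∧ BoundsDisc S (spineHandlebody S 1) c' ∧
        BoundsDisc S (spineHandlebody S 2) c') →
      ¬ IsReducible S →
      ∃ (X' : Type) (_ : TopologicalSpace X') (_ : T2Space X') (_ : SecondCountableTopology X')
        (_ : ChartedSpace (EuclideanSpace ℝ (Fin 4)) X') (_ : IsManifold (𝓡 4) ∞ X')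
        (k' : Fin 3 → ℕ) (S' : Fin 3 → Set X')
        (ℓ : Metric.sphere (0 : EuclideanSpace ℝ (Fin 2)) 1 → X'),
        IsGKTrisection X' 2 k' S' ∧ (∃ i, 2 ≤ k' i + 1) ∧
          Manifold.IsSmoothEmbedding (𝓡 1) (𝓡 4) ∞ ℓ ∧ IsCircleSurgery (𝓡 4) (𝓡 4) X' X ℓ) :
    az2025_weaklyReducible_genusThree_homotopySphere_gk.{u} :=
  az2025_weaklyReducible_genusThree_homotopySphere_gk_of_classification_of_sep_of_loopSurgery_of_fiveChainSurgery'
    hC hsep₀ (msz_loopSurgery_homotopySphere_gk_of_classification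
      (msz_trisection_classification_gk_of_univ hC)) h5

end Literature.Barriers.SmoothPoincare4
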